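import Literature.NumberTheory.ModularSymbols.CuspidalHomologyPushforwardSurjective
import Literature.GroupTheory.Index.HerbrandLemma
import Mathlib.GroupTheory.IndexNSmul
import HarnessLib

/-!
# The Herbrand quotient of `H₁(X₀(N), ℤ)` under the shift `t_*` (`9 ∣ N`):
# `[Λ_B : Nm Λ] · [Λ_P : (t−1)Λ_P] = [Λ_P : Λ₁] · [Λ_B : 3Λ_B]`, `[Λ_P : (t−1)Λ_P]² = [Λ_P : 3Λ_P]`

Topic `Literature/NumberTheory/ModularSymbols`, a leaf over `CuspidalHomologyShiftNorm` /
`CuspidalHomologyNormDegeneracy` / `CuspidalHomologyPushforwardSurjective` (the `C₃ = ⟨t⟩`-lattice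
`Λ = H₁(X₀(N), ℤ) = periodHomologyHecke N` with `t_* = shiftInt`, `Nm = normInt = 1 + t_* + t_*²`,
`Λ_B = fixedLattice = ker(t_* − 1)`, `Λ_P = prymLattice = ker Nm`, `Λ₁ = shiftSubOneLattice = (t_* − 1)Λ`,
`Nm Λ = π^*Λ_{N/3}`) and the tree's Herbrand lemma (O'Meara 65:9, `Literature.GroupTheory.Index.herbrandLemma`).
THEOREMS ONLY: no definition, no named fact, no instance, no `sorry`.

For the cyclic group `⟨t⟩` of order `3` acting on the lattice `Λ`, the Tate groups are
`Ĥ⁰ = Λ_B / Nm Λ` and `Ĥ⁻¹ = Λ_P / Λ₁`, and the HERBRAND QUOTIENT `|Ĥ⁰| / |Ĥ⁻¹|` depends only on the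
rational representation `Λ ⊗ ℚ`.  We prove this here in index form, by O'Meara's lemma applied to the
finite-index sublattice `Λ_B ⊕ Λ_P ⊆ Λ` (`3Λ ⊆ Λ_B + Λ_P`, `Λ_B ∩ Λ_P = 0`), on which `Nm` and `t − 1` act
diagonally (`Nm = 3`, `t − 1 = 0` on `Λ_B`; `Nm = 0`, `(t − 1)² = −3t` on `Λ_P`):

* `relIndex_normInt_mul_eq` — **`[Λ_B : Nm Λ] · [Λ_P : (t−1)Λ_P] = [Λ_P : Λ₁] · [Λ_B : 3Λ_B]`**, all four
  indices finite (non-zero);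
* `relIndex_shiftSubOne_prymLattice_sq` — **`[Λ_P : (t−1)Λ_P]² = [Λ_P : 3Λ_P]`** (`t − 1` is injective on
  `Λ_P` with square `−3t`, and `t` is an automorphism of `Λ_P`);
* (plumbing) `[M : 3M] = 3^{rk M}` for `M = Λ_B, Λ_P` (Mathlib's `AddSubgroup.relIndex_map_nsmul`; sublattices
  of `Λ` are finite free `ℤ`-modules, `moduleFree_int_submodule_periodHomologyHecke`);
* hence `|Ĥ⁰|² · 3^{rk Λ_P} = |Ĥ⁻¹|² · 3^{2 rk Λ_B}` (`relIndex_normInt_sq_mul_eq`): the Herbrand quotient is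
  `|Ĥ⁰| / |Ĥ⁻¹| = 3^{rk Λ_B − rk Λ_P / 2}` (informally `= 3^{3g(X₀(N/3)) − g(X₀(N))}`, as
  `rk Λ_B = 2g(X₀(N/3))` and `rk Λ = 2g(X₀(N))` — the ranks are not computed in this file).

Consequence for the open saturation statement T31 `ShiftFixedLatticeIsTransfer` of route
`TameQuarticManinParity` (stmt-BirchSwinnertonDyer-23689: `Λ_B ≤ π^*Λ_{N/3}`, i.e. `Ĥ⁰ = 0` by
`fixedLattice_le_range_transferInt_iff_le_range_normInt`): it is EQUIVALENT to the pure coinvariant count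
**`[Λ_P : Λ₁] · [Λ_B : 3Λ_B] = [Λ_P : (t−1)Λ_P]`**, i.e. `|Ĥ⁻¹| = 3^{rk Λ_P/2 − rk Λ_B}`
(`fixedLattice_le_range_transferInt_iff_relIndex`), where `Ĥ⁻¹ = Λ_P/Λ₁` is the group E32a describes by
fixed-point symbols (`prymLatticeFixedPointSpan_holds`).  T31 itself is NOT proved here.
Nothing about elliptic curves or Galois representations is asserted; no summit statement is touched.

## References

* O. T. O'Meara, *Introduction to quadratic forms* (1963), §65B Lemma 65:9 (Herbrand's lemma on indices;
  the tree's `Literature.GroupTheory.Index.herbrandLemma`). [Omeara1963]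
* H. Lange, R. E. Rodríguez, *Decomposition of Jacobians by Prym Varieties*, LNM 2310 (2022), §3.2.1,
  Prop. 3.2.2–3.2.4 (PDF p. 55), §4.2.1 (PDF p. 77: cyclic covers of degree `3`, `g̃ = 3g − 2 + b`).
  [LangeRodriguez2022]
* M. Harrison, *A new automorphism of `X₀(108)`* (2011), §2 (the shift `τ ↦ τ + 1/3`). [Harrison2011X0108]
-/

noncomputable section

open scoped MatrixGroups ModularForm

open CongruenceSubgroup
open Literature.NumberTheory.EllipticCurves.ModularForms

namespace Literature.NumberTheory.ModularSymbols

section Plumbing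

variable (N : ℕ) [NeZero N]

/-- Sublattices of `Λ = H₁(X₀(N), ℤ)` are finitely generated `ℤ`-modules (`Λ` is, and `ℤ` is noetherian).
[cite: DarmonDiamondTaylor1995, §1.3 (p. 27)] -/
theorem moduleFinite_int_submodule_periodHomologyHecke (P : Submodule ℤ (periodHomologyHecke N)) :
    Module.Finite ℤ P := by
  haveI := moduleFinite_int_periodHomologyHecke N
  haveI : IsNoetherian ℤ (periodHomologyHecke N) := isNoetherian_of_isNoetherianRing_of_finite ℤ _
  exact Module.Finite.iff_fg.mpr (IsNoetherian.noetherian P)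

/-- Sublattices of `Λ` are torsion-free. [cite: DarmonDiamondTaylor1995, §1.3 (p. 27)] -/
theorem isAddTorsionFree_submodule_periodHomologyHecke (P : Submodule ℤ (periodHomologyHecke N)) :
    IsAddTorsionFree P := by
  haveI := isAddTorsionFree_periodHomologyHecke N
  exact Function.Injective.isAddTorsionFree P.subtype.toAddMonoidHom Subtype.val_injective

/-- Sublattices of `Λ` are free `ℤ`-modules (finitely generated and torsion-free over a PID).
[cite: DarmonDiamondTaylor1995, §1.3 (p. 27)] -/
theorem moduleFree_int_submodule_periodHomologyHecke (P : Submodule ℤ (periodHomologyHecke N)) :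
    Module.Free ℤ P := by
  haveI := moduleFinite_int_submodule_periodHomologyHecke N P
  haveI := isAddTorsionFree_submodule_periodHomologyHecke N P
  exact Module.free_of_finite_type_torsion_free'

/-- **`[M : n M] = n ^ rk M`** for a sublattice `M ⊆ Λ` (Mathlib's `AddSubgroup.relIndex_map_nsmul` for the
finite free `ℤ`-module `M`). [folklore] -/
private theorem relIndex_map_nsmul_eq_pow_finrank (P : Submodule ℤ (periodHomologyHecke N)) (n : ℕ) :
    (P.toAddSubgroup.map (nsmulAddMonoidHom (α := periodHomologyHecke N) n)).relIndex P.toAddSubgroup =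
      n ^ Module.finrank ℤ P := by
  haveI : Module.Free ℤ ↥(AddSubgroup.toIntSubmodule P.toAddSubgroup) := by
    rw [Submodule.toAddSubgroup_toIntSubmodule]; exact moduleFree_int_submodule_periodHomologyHecke N P
  haveI : Module.Finite ℤ ↥(AddSubgroup.toIntSubmodule P.toAddSubgroup) := by
    rw [Submodule.toAddSubgroup_toIntSubmodule]; exact moduleFinite_int_submodule_periodHomologyHecke N P
  exact AddSubgroup.relIndex_map_nsmul n P.toAddSubgroup

end Plumbing

section Herbrand

variable (N : ℕ) [NeZero N] (h9 : 3 ^ 2 ∣ N)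

/-! ### The two endomorphisms on the pieces `Λ_B`, `Λ_P` -/

/-- `Nm x = 3 • x` for `x ∈ Λ_B`. [cite: Harrison2011X0108, §2] -/
theorem normInt_eq_three_smul_of_mem_fixedLattice {x : periodHomologyHecke N} (hx : x ∈ fixedLattice N h9) :
    normInt N h9 x = 3 • x := by
  rw [mem_fixedLattice_iff] at hx
  rw [normInt_apply, hx, hx]
  abel

/-- `(t − 1) x ∈ Λ_P` for every `x ∈ Λ`. [cite: Harrison2011X0108, §2] -/
theorem shiftInt_sub_one_apply_mem_prymLattice (x : periodHomologyHecke N) :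
    (shiftInt N h9 - 1) x ∈ prymLattice N h9 := by
  have h := neg_mem (sub_shiftInt_mem_prymLattice N h9 x)
  rwa [neg_sub] at h

/-- `(t − 1) x = 0` for `x ∈ Λ_B`. [cite: Harrison2011X0108, §2] -/
theorem shiftInt_sub_one_apply_eq_zero_of_mem_fixedLattice {x : periodHomologyHecke N}
    (hx : x ∈ fixedLattice N h9) : (shiftInt N h9 - 1) x = 0 :=
  hx

/-- **`(t − 1)² y = −3 • t y` for `y ∈ Λ_P`** (`(t−1)² = Nm − 3t` and `Nm y = 0`). [cite: Harrison2011X0108, §2] -/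
theorem shiftInt_sub_one_sq_apply_of_mem_prymLattice {y : periodHomologyHecke N} (hy : y ∈ prymLattice N h9) :
    (shiftInt N h9 - 1) ((shiftInt N h9 - 1) y) = -(3 • shiftInt N h9 y) := by
  rw [mem_prymLattice_iff, normInt_apply] at hy
  have ht : shiftInt N h9 (shiftInt N h9 y) = -y - shiftInt N h9 y := by
    rw [eq_sub_iff_add_eq, eq_neg_iff_add_eq_zero, ← hy]; abel
  simp only [LinearMap.sub_apply, Module.End.one_apply, map_sub, ht]
  abel

/-! ### `Nm` and `t − 1` on `Φ = Λ_B ⊕ Λ_P` -/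

/-- `Λ_B ⊕ Λ_P` has finite index in `Λ` (`3Λ ⊆ Λ_B + Λ_P`). [cite: Harrison2011X0108, §2] -/
theorem index_fixedLattice_sup_prymLattice_ne_zero :
    (fixedLattice N h9 ⊔ prymLattice N h9).toAddSubgroup.index ≠ 0 := by
  haveI := moduleFree_int_periodHomologyHecke N
  haveI := moduleFinite_int_periodHomologyHecke N
  have hle : (nsmulAddMonoidHom (α := periodHomologyHecke N) 3).range ≤
      (fixedLattice N h9 ⊔ prymLattice N h9).toAddSubgroup := by
    rintro _ ⟨x, rfl⟩
    exact three_smul_mem_sup N h9 x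
  have h3 : (nsmulAddMonoidHom (α := periodHomologyHecke N) 3).range.index ≠ 0 := by
    rw [AddSubgroup.index_range_nsmul (periodHomologyHecke N) 3]
    exact pow_ne_zero _ three_ne_zero
  exact ne_zero_of_dvd_ne_zero h3 (AddSubgroup.index_dvd_of_le hle)

/-- `Nm (Λ_B ⊕ Λ_P) = 3 Λ_B` (`Nm = 3` on `Λ_B`, `Nm = 0` on `Λ_P`). [cite: Harrison2011X0108, §2] -/
theorem map_normInt_fixedLattice_sup_prymLattice :
    (fixedLattice N h9 ⊔ prymLattice N h9).toAddSubgroup.map (normInt N h9).toAddMonoidHom =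
      (fixedLattice N h9).toAddSubgroup.map (nsmulAddMonoidHom (α := periodHomologyHecke N) 3) := by
  ext x
  simp only [AddSubgroup.mem_map, Submodule.mem_toAddSubgroup, LinearMap.toAddMonoidHom_coe,
    nsmulAddMonoidHom_apply]
  constructor
  · rintro ⟨y, hy, rfl⟩
    obtain ⟨b, hb, p, hp, rfl⟩ := Submodule.mem_sup.mp hy
    refine ⟨b, hb, ?_⟩
    rw [map_add, (mem_prymLattice_iff N h9 p).mp hp, add_zero, normInt_eq_three_smul_of_mem_fixedLattice N h9 hb]
  · rintro ⟨b, hb, rfl⟩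
    exact ⟨b, Submodule.mem_sup_left hb, normInt_eq_three_smul_of_mem_fixedLattice N h9 hb⟩

/-- `(t − 1)(Λ_B ⊕ Λ_P) = (t − 1) Λ_P`. [cite: Harrison2011X0108, §2] -/
theorem map_shiftInt_sub_one_fixedLattice_sup_prymLattice :
    (fixedLattice N h9 ⊔ prymLattice N h9).toAddSubgroup.map (shiftInt N h9 - 1).toAddMonoidHom =
      (prymLattice N h9).toAddSubgroup.map (shiftInt N h9 - 1).toAddMonoidHom := by
  ext x
  simp only [AddSubgroup.mem_map, Submodule.mem_toAddSubgroup, LinearMap.toAddMonoidHom_coe]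
  constructor
  · rintro ⟨y, hy, rfl⟩
    obtain ⟨b, hb, p, hp, rfl⟩ := Submodule.mem_sup.mp hy
    refine ⟨p, hp, ?_⟩
    rw [map_add, shiftInt_sub_one_apply_eq_zero_of_mem_fixedLattice N h9 hb, zero_add]
  · rintro ⟨p, hp, rfl⟩
    exact ⟨p, Submodule.mem_sup_right hp, rfl⟩

/-! ### `[Λ_P : (t − 1)Λ_P]² = [Λ_P : 3Λ_P]`, inside the lattice `Λ_P` -/

/-- `t − 1` preserves `Λ_P` (indeed maps `Λ` into `Λ_P`). [cite: Harrison2011X0108, §2] -/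
theorem shiftInt_sub_one_mapsTo_prymLattice :
    ∀ x ∈ prymLattice N h9, (shiftInt N h9 - 1) x ∈ prymLattice N h9 :=
  fun x _ ↦ shiftInt_sub_one_apply_mem_prymLattice N h9 x

/-- **`t − 1` is injective on `Λ_P`** (`ker(t − 1) ∩ Λ_P = Λ_B ∩ Λ_P = 0`). [cite: Harrison2011X0108, §2] -/
theorem shiftInt_sub_one_restrict_prymLattice_injective :
    Function.Injective ((shiftInt N h9 - 1).restrict (shiftInt_sub_one_mapsTo_prymLattice N h9)) := by
  rw [← LinearMap.ker_eq_bot, Submodule.eq_bot_iff]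
  intro y hy
  rw [LinearMap.mem_ker, Subtype.ext_iff, LinearMap.coe_restrict_apply, Submodule.coe_zero] at hy
  have hB : (y : periodHomologyHecke N) ∈ fixedLattice N h9 := hy
  have h0 : (y : periodHomologyHecke N) ∈ fixedLattice N h9 ⊓ prymLattice N h9 := ⟨hB, y.2⟩
  rw [fixedLattice_inf_prymLattice N h9, Submodule.mem_bot] at h0
  exact Subtype.ext h0

/-- **`((t − 1)|_{Λ_P})²` has the same image as multiplication by `3` on `Λ_P`**:
`(t − 1)²Λ_P = 3 t Λ_P = 3 Λ_P` (`t` is an automorphism of `Λ_P`, `t³ = 1`). [cite: Harrison2011X0108, §2] -/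
theorem range_shiftInt_sub_one_restrict_sq_eq_range_nsmul :
    (((shiftInt N h9 - 1).restrict (shiftInt_sub_one_mapsTo_prymLattice N h9)).toAddMonoidHom.comp
        ((shiftInt N h9 - 1).restrict (shiftInt_sub_one_mapsTo_prymLattice N h9)).toAddMonoidHom).range =
      (nsmulAddMonoidHom (α := prymLattice N h9) 3).range := by
  ext x
  simp only [AddMonoidHom.mem_range, AddMonoidHom.coe_comp, Function.comp_apply,
    LinearMap.toAddMonoidHom_coe, nsmulAddMonoidHom_apply]
  constructor
  · rintro ⟨y, rfl⟩
    refine ⟨⟨-(shiftInt N h9 y), neg_mem (shiftInt_mem_prymLattice N h9 y.2)⟩, ?_⟩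
    apply Subtype.ext
    simp only [Submodule.coe_smul_of_tower, LinearMap.coe_restrict_apply, smul_neg]
    exact (shiftInt_sub_one_sq_apply_of_mem_prymLattice N h9 y.2).symm
  · rintro ⟨z, rfl⟩
    refine ⟨⟨-(shiftInt N h9 (shiftInt N h9 z)),
      neg_mem (shiftInt_mem_prymLattice N h9 (shiftInt_mem_prymLattice N h9 z.2))⟩, ?_⟩
    apply Subtype.ext
    simp only [Submodule.coe_smul_of_tower, LinearMap.coe_restrict_apply]
    rw [shiftInt_sub_one_sq_apply_of_mem_prymLattice N h9
      (neg_mem (shiftInt_mem_prymLattice N h9 (shiftInt_mem_prymLattice N h9 z.2))),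
      map_neg, shiftInt_shiftInt_shiftInt, smul_neg, neg_neg]

/-- The index `[Λ_P : (t − 1)Λ_P]` computed inside `Λ_P`: the relative index in `Λ` of `(t − 1)Λ_P` in
`Λ_P` is the index of the image of `(t − 1)|_{Λ_P}`. [folklore] -/
private theorem relIndex_map_shiftInt_sub_one_prymLattice_eq_index :
    ((prymLattice N h9).toAddSubgroup.map (shiftInt N h9 - 1).toAddMonoidHom).relIndex
        (prymLattice N h9).toAddSubgroup =
      ((shiftInt N h9 - 1).restrict (shiftInt_sub_one_mapsTo_prymLattice N h9)).toAddMonoidHom.range.index := by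
  rw [AddSubgroup.relIndex]
  congr 1
  ext y
  simp only [AddSubgroup.mem_addSubgroupOf, AddSubgroup.mem_map, Submodule.mem_toAddSubgroup,
    LinearMap.toAddMonoidHom_coe, AddMonoidHom.mem_range]
  constructor
  · rintro ⟨p, hp, hpy⟩
    exact ⟨⟨p, hp⟩, Subtype.ext (by rw [LinearMap.coe_restrict_apply]; exact hpy)⟩
  · rintro ⟨p, rfl⟩
    exact ⟨p, p.2, (LinearMap.coe_restrict_apply _ _).symm⟩

/-- **`[Λ_P : (t − 1)Λ_P]² = [Λ_P : 3Λ_P] = 3^{rk Λ_P}`** (so `[Λ_P : (t−1)Λ_P] = 3^{rk Λ_P / 2}`): `t − 1` is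
injective on `Λ_P`, so `[Λ_P : (t−1)Λ_P] · [Λ_P : (t−1)Λ_P] = [Λ_P : (t−1)²Λ_P]`, and `(t−1)²Λ_P = 3Λ_P`.
[cite: LangeRodriguez2022, §4.2.1 (PDF p. 77) (derived reading: the ℤ[ζ₃]-lattice Λ_P, (1−ζ)² ∼ 3)] -/
theorem relIndex_shiftSubOne_prymLattice_sq :
    ((prymLattice N h9).toAddSubgroup.map (shiftInt N h9 - 1).toAddMonoidHom).relIndex
        (prymLattice N h9).toAddSubgroup ^ 2 = 3 ^ Module.finrank ℤ (prymLattice N h9) := by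
  haveI := moduleFree_int_submodule_periodHomologyHecke N (prymLattice N h9)
  haveI := moduleFinite_int_submodule_periodHomologyHecke N (prymLattice N h9)
  set TP := ((shiftInt N h9 - 1).restrict (shiftInt_sub_one_mapsTo_prymLattice N h9)).toAddMonoidHom
    with hTP
  have hinj : Function.Injective TP := shiftInt_sub_one_restrict_prymLattice_injective N h9
  rw [relIndex_map_shiftInt_sub_one_prymLattice_eq_index, ← hTP, sq,
    ← TP.range.index_map_of_injective hinj, ← AddMonoidHom.range_comp,
    range_shiftInt_sub_one_restrict_sq_eq_range_nsmul N h9, AddSubgroup.index_range_nsmul]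

/-- `[Λ_P : (t − 1)Λ_P] ≠ 0`. [cite: Harrison2011X0108, §2] -/
theorem relIndex_shiftSubOne_prymLattice_ne_zero :
    ((prymLattice N h9).toAddSubgroup.map (shiftInt N h9 - 1).toAddMonoidHom).relIndex
        (prymLattice N h9).toAddSubgroup ≠ 0 := by
  intro h
  have hsq := relIndex_shiftSubOne_prymLattice_sq N h9
  rw [h, sq, mul_zero] at hsq
  exact pow_ne_zero _ three_ne_zero hsq.symm

/-- **`[Λ_B : 3Λ_B] = 3^{rk Λ_B}`**. [folklore] -/
private theorem relIndex_three_nsmul_fixedLattice :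
    ((fixedLattice N h9).toAddSubgroup.map (nsmulAddMonoidHom (α := periodHomologyHecke N) 3)).relIndex
        (fixedLattice N h9).toAddSubgroup = 3 ^ Module.finrank ℤ (fixedLattice N h9) :=
  relIndex_map_nsmul_eq_pow_finrank N (fixedLattice N h9) 3

/-- **`[Λ_P : 3Λ_P] = 3^{rk Λ_P}`**. [folklore] -/
private theorem relIndex_three_nsmul_prymLattice :
    ((prymLattice N h9).toAddSubgroup.map (nsmulAddMonoidHom (α := periodHomologyHecke N) 3)).relIndex
        (prymLattice N h9).toAddSubgroup = 3 ^ Module.finrank ℤ (prymLattice N h9) :=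
  relIndex_map_nsmul_eq_pow_finrank N (prymLattice N h9) 3

/-! ### Herbrand's lemma applied to `Λ_B ⊕ Λ_P ⊆ Λ` -/

/-- **Herbrand quotient of `⟨t⟩` on `H₁(X₀(N), ℤ)`, index form** (`9 ∣ N`):
`[Λ_B : Nm Λ] · [Λ_P : (t − 1)Λ_P] = [Λ_P : Λ₁] · [Λ_B : 3Λ_B]`, with `[Λ_B : Nm Λ]` and `[Λ_P : Λ₁]`
finite — O'Meara's Lemma 65:9 (`herbrandLemma`) for the endomorphisms `Nm`, `t − 1` of `Λ`
(`Nm (t−1) = (t−1) Nm = 0`) and the finite-index sublattice `Φ = Λ_B ⊕ Λ_P`, on which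
`Nm Φ = 3Λ_B`, `(t−1)Φ = (t−1)Λ_P`, `Φ ∩ ker(t−1) = Λ_B`, `Φ ∩ ker Nm = Λ_P`.  Here
`[Λ_B : Nm Λ] = |Ĥ⁰(⟨t⟩, Λ)|` and `[Λ_P : Λ₁] = |Ĥ⁻¹(⟨t⟩, Λ)|`.
[cite: Omeara1963, §65B Lemma 65:9] -/
theorem relIndex_normInt_mul_eq :
    (LinearMap.range (normInt N h9)).toAddSubgroup.relIndex (fixedLattice N h9).toAddSubgroup *
        ((prymLattice N h9).toAddSubgroup.map (shiftInt N h9 - 1).toAddMonoidHom).relIndex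
          (prymLattice N h9).toAddSubgroup =
      (shiftSubOneLattice N h9).toAddSubgroup.relIndex (prymLattice N h9).toAddSubgroup *
        ((fixedLattice N h9).toAddSubgroup.map (nsmulAddMonoidHom (α := periodHomologyHecke N) 3)).relIndex
          (fixedLattice N h9).toAddSubgroup ∧
    (LinearMap.range (normInt N h9)).toAddSubgroup.relIndex (fixedLattice N h9).toAddSubgroup ≠ 0 ∧
    (shiftSubOneLattice N h9).toAddSubgroup.relIndex (prymLattice N h9).toAddSubgroup ≠ 0 := by
  -- the data of Herbrand's lemma, on `G = Multiplicative Λ`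
  let Nm' := AddMonoidHom.toMultiplicative (normInt N h9).toAddMonoidHom
  let T' := AddMonoidHom.toMultiplicative (shiftInt N h9 - 1).toAddMonoidHom
  let Φ := (fixedLattice N h9 ⊔ prymLattice N h9).toAddSubgroup
  have hNT : ∀ g, Nm' (T' g) = 1 := fun g ↦ by
    change Multiplicative.ofAdd (normInt N h9 ((shiftInt N h9 - 1) g.toAdd)) = 1
    rw [← Module.End.mul_apply, normInt_mul_shiftInt_sub_one, LinearMap.zero_apply, ofAdd_zero]
  have hTN : ∀ g, T' (Nm' g) = 1 := fun g ↦ by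
    change Multiplicative.ofAdd ((shiftInt N h9 - 1) (normInt N h9 g.toAdd)) = 1
    rw [← Module.End.mul_apply, shiftInt_sub_one_mul_normInt, LinearMap.zero_apply, ofAdd_zero]
  have hBΦ : (fixedLattice N h9).toAddSubgroup ≤ Φ := fun x hx ↦ Submodule.mem_sup_left hx
  have hPΦ : (prymLattice N h9).toAddSubgroup ≤ Φ := fun x hx ↦ Submodule.mem_sup_right hx
  have hN : Φ.map (normInt N h9).toAddMonoidHom ≤ Φ := by
    rintro _ ⟨y, -, rfl⟩
    exact hBΦ (normInt_mem_fixedLattice N h9 y)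
  have hT : Φ.map (shiftInt N h9 - 1).toAddMonoidHom ≤ Φ := by
    rintro _ ⟨y, -, rfl⟩
    exact hPΦ (shiftInt_sub_one_apply_mem_prymLattice N h9 y)
  -- kernels and images
  have hkerT : (shiftInt N h9 - 1).toAddMonoidHom.ker = (fixedLattice N h9).toAddSubgroup := rfl
  have hkerN : (normInt N h9).toAddMonoidHom.ker = (prymLattice N h9).toAddSubgroup := rfl
  have hranT : (shiftInt N h9 - 1).toAddMonoidHom.range = (shiftSubOneLattice N h9).toAddSubgroup := rfl
  have hranN : (normInt N h9).toAddMonoidHom.range = (LinearMap.range (normInt N h9)).toAddSubgroup := rfl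
  have hΦT : Φ ⊓ (shiftInt N h9 - 1).toAddMonoidHom.ker = (fixedLattice N h9).toAddSubgroup := by
    rw [hkerT]; exact inf_eq_right.mpr hBΦ
  have hΦN : Φ ⊓ (normInt N h9).toAddMonoidHom.ker = (prymLattice N h9).toAddSubgroup := by
    rw [hkerN]; exact inf_eq_right.mpr hPΦ
  have h₁ : (Φ.map (normInt N h9).toAddMonoidHom).relIndex (Φ ⊓ (shiftInt N h9 - 1).toAddMonoidHom.ker) ≠ 0 := by
    rw [hΦT, map_normInt_fixedLattice_sup_prymLattice N h9, relIndex_three_nsmul_fixedLattice N h9]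
    exact pow_ne_zero _ three_ne_zero
  have h₂ : (Φ.map (shiftInt N h9 - 1).toAddMonoidHom).relIndex (Φ ⊓ (normInt N h9).toAddMonoidHom.ker) ≠ 0 := by
    rw [hΦN, map_shiftInt_sub_one_fixedLattice_sup_prymLattice N h9]
    exact relIndex_shiftSubOne_prymLattice_ne_zero N h9
  -- Herbrand's lemma (multiplicative), read back additively (all bridges are definitional)
  have H := Literature.GroupTheory.Index.herbrandLemma Nm' T' hNT hTN (AddSubgroup.toSubgroup Φ)
    (by rw [AddSubgroup.index_toSubgroup]; exact index_fixedLattice_sup_prymLattice_ne_zero N h9)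
    (fun x hx ↦ by
      obtain ⟨y, hy, rfl⟩ := hx
      exact hN ⟨y, hy, rfl⟩)
    (fun x hx ↦ by
      obtain ⟨y, hy, rfl⟩ := hx
      exact hT ⟨y, hy, rfl⟩)
    (by
      change (Φ.map (normInt N h9).toAddMonoidHom).relIndex (Φ ⊓ (shiftInt N h9 - 1).toAddMonoidHom.ker) ≠ 0
      exact h₁)
    (by
      change (Φ.map (shiftInt N h9 - 1).toAddMonoidHom).relIndex (Φ ⊓ (normInt N h9).toAddMonoidHom.ker) ≠ 0
      exact h₂)
  change (normInt N h9).toAddMonoidHom.range.relIndex (shiftInt N h9 - 1).toAddMonoidHom.ker *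
        (Φ.map (shiftInt N h9 - 1).toAddMonoidHom).relIndex (Φ ⊓ (normInt N h9).toAddMonoidHom.ker) =
      (shiftInt N h9 - 1).toAddMonoidHom.range.relIndex (normInt N h9).toAddMonoidHom.ker *
        (Φ.map (normInt N h9).toAddMonoidHom).relIndex (Φ ⊓ (shiftInt N h9 - 1).toAddMonoidHom.ker) ∧
    (normInt N h9).toAddMonoidHom.range.relIndex (shiftInt N h9 - 1).toAddMonoidHom.ker ≠ 0 ∧
    (shiftInt N h9 - 1).toAddMonoidHom.range.relIndex (normInt N h9).toAddMonoidHom.ker ≠ 0 at H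
  rw [hΦT, hΦN, hkerT, hkerN, hranT, hranN, map_normInt_fixedLattice_sup_prymLattice N h9,
    map_shiftInt_sub_one_fixedLattice_sup_prymLattice N h9] at H
  exact H

/-- **The Herbrand quotient squared**: `[Λ_B : Nm Λ]² · 3^{rk Λ_P} = [Λ_P : Λ₁]² · 3^{2 rk Λ_B}`, i.e.
`|Ĥ⁰| / |Ĥ⁻¹| = 3^{rk Λ_B − rk Λ_P/2}` for the `⟨t⟩`-lattice `H₁(X₀(N), ℤ)` (`9 ∣ N`).
[cite: Omeara1963, §65B Lemma 65:9] [cite: LangeRodriguez2022, §4.2.1 (PDF p. 77) (derived reading)] -/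
theorem relIndex_normInt_sq_mul_eq :
    (LinearMap.range (normInt N h9)).toAddSubgroup.relIndex (fixedLattice N h9).toAddSubgroup ^ 2 *
        3 ^ Module.finrank ℤ (prymLattice N h9) =
      (shiftSubOneLattice N h9).toAddSubgroup.relIndex (prymLattice N h9).toAddSubgroup ^ 2 *
        3 ^ (2 * Module.finrank ℤ (fixedLattice N h9)) := by
  obtain ⟨h, -, -⟩ := relIndex_normInt_mul_eq N h9
  rw [relIndex_three_nsmul_fixedLattice N h9] at h
  have h2 := congrArg (fun n : ℕ ↦ n ^ 2) h
  simp only [mul_pow] at h2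
  rw [relIndex_shiftSubOne_prymLattice_sq N h9, ← pow_mul, mul_comm (Module.finrank ℤ _) 2] at h2
  exact h2

/-! ### What this says about the saturation `Λ_B = π^* Λ_{N/3}` (T31) -/

/-- `Λ_B ≤ Nm Λ` iff `[Λ_B : Nm Λ] = 1`. [folklore] -/
private theorem fixedLattice_le_range_normInt_iff_relIndex_eq_one :
    fixedLattice N h9 ≤ LinearMap.range (normInt N h9) ↔
      (LinearMap.range (normInt N h9)).toAddSubgroup.relIndex (fixedLattice N h9).toAddSubgroup = 1 := by
  rw [AddSubgroup.relIndex_eq_one, Submodule.toAddSubgroup_le]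

/-- **T31 ⟺ a coinvariant count** (`9 ∣ N`): the saturation `Λ_B ≤ π^*Λ_{N/3}` (`Ĥ⁰(⟨t⟩, Λ) = 0`, item
T31 `ShiftFixedLatticeIsTransfer` of route `TameQuarticManinParity`, stmt-BirchSwinnertonDyer-23689, NOT
proved here) holds iff **`[Λ_P : Λ₁] · 3^{rk Λ_B} = [Λ_P : (t − 1)Λ_P]`** (`3^{rk Λ_B} = [Λ_B : 3Λ_B]`), i.e. iff
`|Ĥ⁻¹(⟨t⟩, Λ)| = |Λ_P/Λ₁| = 3^{rk Λ_P/2 − rk Λ_B}` — by the Herbrand identity `relIndex_normInt_mul_eq` and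
`π^*Λ_{N/3} = Nm Λ` (`fixedLattice_le_range_transferInt_iff_le_range_normInt`).
[cite: Omeara1963, §65B Lemma 65:9] [cite: LangeRodriguez2022, Prop. 3.2.2–3.2.4 (PDF p. 55) (derived reading)] -/
theorem fixedLattice_le_range_transferInt_iff_relIndex [NeZero (N / 3)] :
    fixedLattice N h9 ≤ LinearMap.range (transferInt N h9) ↔
      (shiftSubOneLattice N h9).toAddSubgroup.relIndex (prymLattice N h9).toAddSubgroup *
          3 ^ Module.finrank ℤ (fixedLattice N h9) =
        ((prymLattice N h9).toAddSubgroup.map (shiftInt N h9 - 1).toAddMonoidHom).relIndex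
          (prymLattice N h9).toAddSubgroup := by
  rw [fixedLattice_le_range_transferInt_iff_le_range_normInt, fixedLattice_le_range_normInt_iff_relIndex_eq_one]
  obtain ⟨h, -, -⟩ := relIndex_normInt_mul_eq N h9
  rw [relIndex_three_nsmul_fixedLattice N h9] at h
  have ha := relIndex_shiftSubOne_prymLattice_ne_zero N h9
  constructor
  · intro h1
    rw [h1, one_mul] at h
    exact h.symm
  · intro h2
    rw [← h2] at h
    exact (Nat.eq_of_mul_eq_mul_right (Nat.pos_of_ne_zero (h2 ▸ ha)) (h.trans (one_mul _).symm))

/-- **T31 ⟺ `[Λ_P : Λ₁]² · 3^{2 rk Λ_B} = 3^{rk Λ_P}`** (the same count with the index of `(t − 1)Λ_P`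
eliminated by `relIndex_shiftSubOne_prymLattice_sq`). [cite: Omeara1963, §65B Lemma 65:9] [cite: LangeRodriguez2022, Prop. 3.2.2–3.2.4 (PDF p. 55) (derived reading)] -/
theorem fixedLattice_le_range_transferInt_iff_relIndex_sq [NeZero (N / 3)] :
    fixedLattice N h9 ≤ LinearMap.range (transferInt N h9) ↔
      (shiftSubOneLattice N h9).toAddSubgroup.relIndex (prymLattice N h9).toAddSubgroup ^ 2 *
          3 ^ (2 * Module.finrank ℤ (fixedLattice N h9)) = 3 ^ Module.finrank ℤ (prymLattice N h9) := by
  rw [fixedLattice_le_range_transferInt_iff_relIndex N h9]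
  have hsq := relIndex_shiftSubOne_prymLattice_sq N h9
  constructor
  · intro h
    rw [← hsq, ← h, mul_pow, ← pow_mul, mul_comm (Module.finrank ℤ _) 2]
  · intro h
    have h' : ((shiftSubOneLattice N h9).toAddSubgroup.relIndex (prymLattice N h9).toAddSubgroup *
        3 ^ Module.finrank ℤ (fixedLattice N h9)) ^ 2 =
        ((prymLattice N h9).toAddSubgroup.map (shiftInt N h9 - 1).toAddMonoidHom).relIndex
          (prymLattice N h9).toAddSubgroup ^ 2 := by
      rw [mul_pow, ← pow_mul, mul_comm (Module.finrank ℤ _) 2, h, hsq]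
    exact (Nat.pow_left_injective two_ne_zero) h'

end Herbrand

end Literature.NumberTheory.ModularSymbols

end
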